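/-
Copyright (c) 2026. All rights reserved.
Released under Apache 2.0 license as described in the file LICENSE.
Authors: abc-iut cell, prover seat abc-iut-f-102 (F fact-proving wave, gen 4), over abc-iut-L4-t3's `IotaOver` /
`LamOverLink` add-ons and abc-iut-w4-d095's genuine carriers (see the imports).
-/
import Literature.AnabelianGeometry.AbsoluteAnabelian.LogFrobeniusRealisesIff
import Literature.AnabelianGeometry.AbsoluteAnabelian.LogFrobeniusNonarchGenuineOverLamOverLink
import Literature.AnabelianGeometry.AbsoluteAnabelian.LogFrobeniusGenuineIotaOver
import Literature.AnabelianGeometry.AbsoluteAnabelian.LogFrobeniusGenuineCoreRigid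
import Literature.AnabelianGeometry.AbsoluteAnabelian.LogFrobeniusArchGenuineObservables
import Literature.AnabelianGeometry.AbsoluteAnabelian.LogFrobeniusLogWallNonarchModel
import HarnessLib

/-!
# [AbsTopIII] Cor 5.5 (i)/(iii)/(v): THEOREM B FIRED AT THE GENUINE CARRIERS — F-0159 / F-0157 proved, F-0156 decided, at every genuine setting of the tree

S. Mochizuki, *Topics in absolute anabelian geometry III: global reconstruction algorithms*,
J. Math. Sci. Univ. Tokyo 22 (2015) 939–1156 [MochizukiAbsTopIII2015]; locators `p.N` = pages of the author's
manuscript (`paper:url-5493eb38cbb7`), read on the page: Def 5.4 (iii) p. 126 (the commuting `ι`-squares of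
`Γ⃗^log_v`), (iv) pp. 126–127 and (vii) p. 128 ("lies over `Th•[Z]`"), Cor 5.5 (i) p. 130, (iii) p. 131, (v) pp. 131–133
(proof p. 133: "the total `□`-rigidity in question follows immediately from the fact that `𝒳` is id-rigid").

PROOF-ONLY (no `def`, nothing restated; FACT-LIST rows F-0159 `RealisesCor55Families` (∃-form), F-0157
`Cor55ShiftAction`, F-0156 `Cor55Rigidity` of tranche 102).  The f-102 lineage's THEOREM B
(`cor55ShiftAction_of_iotaOver`, `exists_realisesCor55Families_iff`) reads, at a setting `L` over a nonempty `V(F_mod)`,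
three interface-level inputs: the `ι⊞`-squares commute (abc-iut-f-101's `IotaSquaresCommute`, Def 5.4 (iii)), the
`ι⊞_{v,ε}` lie over `Th•[Z]` (abc-iut-L4-t3's add-on `IotaOver`, Def 5.4 (vii)), and the space-link / post-log vertices
carry one over-structure (abc-iut-L4-t3's add-on `LamOverLink`, Cor 5.5 p. 130 proviso) — the last two turned into
THEOREM B's component hypotheses `hpre` / `hpost` by abc-iut-L4-t3's `IotaOver.toE_map_iota_heq_of_preLog` /
`IotaOver.toE_map_iota_heq_spaceLink`.  This file

1. composes them once at the interface (`realises_and_cor55ShiftAction_of_iotaOver_lamOverLink` and corollaries;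
   `cor55ShiftAction_iff_nonempty_of_iotaOver_lamOverLink`, `cor55Rigidity_iff_of_iotaOver_lamOverLink`), and
2. FIRES the composite BY NAME at every setting of the tree with genuine components, where all three inputs are
   already theorems: abc-iut-w4-d095's setting over any sub-model `nonarchGenuineOver p ι` and its SLIM carrier
   `nonarchGenuineSlim p` (inputs `nonarchGenuineOver_iotaSquaresCommute`, `nonarchGenuineOver_iotaOver`,
   `nonarchGenuineOver_lamOverLink`), the bare genuine-nonarchimedean settings `nonarchGenuine p` /
   `nonarchGenuineMono p`, and the genuine-archimedean setting `archGenuine 𝔄` (abc-iut-L4-t15 / w4-d020 lineages).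

RESULTS (model level; `[Nonempty Vmod]` = "`V(F_mod) ≠ ∅`", necessary by `nonempty_of_cor55ShiftAction`):
* F-0159 and F-0157 HOLD at all five carriers (`…_exists_realisesCor55Families`, `…_cor55ShiftAction`), and are
  EQUIVALENT there to `Nonempty Vmod` (`…_cor55ShiftAction_iff`);
* F-0156 (`Cor55Rigidity` = F-0155 ∧ F-0157) HOLDS at the slim carrier (`nonarchGenuineSlim_cor55Rigidity`, the
  print-shaped base: id-rigid by Prop 3.2 (iv)), at the geometric archimedean carrier `{ℂ, ℂˣ, 𝔻}`
  (`archGenuine_carriers_cor55Rigidity`) and at the Galois-category carrier of a slim profinite group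
  (`archGenuine_ofGaloisCategory_cor55Rigidity_of_isSlimGroup`); over a general sub-model it is EXACTLY `IsIdRigid C`
  (`nonarchGenuineOver_cor55Rigidity_iff_isIdRigid`), at `archGenuine 𝔄` exactly `IsIdRigid EA`
  (`archGenuine_cor55Rigidity_iff_isIdRigid_EA`), and it FAILS at the bare (non-id-rigid) model carriers
  (abc-iut-w4-d020's `nonarchGenuine_not_cor55Rigidity`, recalled in `nonarchGenuine_cor55ShiftAction_not_cor55Rigidity`).

Honest framing: instance at a model ≠ the printed theorem for the printed theaters; a FACT row is an assumption label;
refereed pre-IUT material; nothing here bears on [IUTchIII] Cor. 3.12; no side taken; typed ≠ proved.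
-/

set_option autoImplicit false

universe u

open CategoryTheory

namespace Literature.AnabelianGeometry.AbsoluteAnabelian

namespace LogFrobeniusSetting

/-! ## 1. THEOREM B composed with the `IotaOver` / `LamOverLink` add-ons (interface level) -/

section Interface

variable {Vmod : Type u} {isArc : Vmod → Bool} (L : LogFrobeniusSetting Vmod isArc)

/-- **THEOREM B from the add-on laws.**  If the `ι⊞`-squares commute (Def 5.4 (iii)), the `ι⊞_{v,ε}` lie over `Th•[Z]`
(`IotaOver`, Def 5.4 (vii)) and the space-link / post-log vertices carry one over-structure (`LamOverLink`, Cor 5.5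
p. 130 proviso), then over a nonempty `V(F_mod)` the cores / observables of Cor 5.5 (i)/(iii) are realised by one family
of homotopies on `D•⊢` (F-0159) AND the `ℤ`-action clause of Cor 5.5 (v) holds (F-0157).
[cite: MochizukiAbsTopIII2015, Cor 5.5 (v) pp. 131–133] -/
theorem realises_and_cor55ShiftAction_of_iotaOver_lamOverLink [Nonempty Vmod] (hsq : ∀ v, L.IotaSquaresCommute v)
    (hι : L.IotaOver) (hΛ : L.LamOverLink) :
    (∃ K : L.diagram.HomotopyFamily, L.RealisesCor55Families K) ∧ L.Cor55ShiftAction :=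
  L.cor55ShiftAction_of_iotaOver hsq (fun v _ _ ε h₁ _ X₀ => hι.toE_map_iota_heq_of_preLog v ε h₁ X₀)
    (fun v _ _ ε h₁ _ X₀ => hι.toE_map_iota_heq_spaceLink hΛ v ε h₁ X₀)

/-- **F-0159 from the add-on laws** (∃-form of `RealisesCor55Families`). [cite: MochizukiAbsTopIII2015, Cor 5.5 (iii) p. 131] -/
theorem exists_realisesCor55Families_of_iotaOver_lamOverLink [Nonempty Vmod] (hsq : ∀ v, L.IotaSquaresCommute v)
    (hι : L.IotaOver) (hΛ : L.LamOverLink) : ∃ K : L.diagram.HomotopyFamily, L.RealisesCor55Families K :=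
  (L.realises_and_cor55ShiftAction_of_iotaOver_lamOverLink hsq hι hΛ).1

/-- **F-0157 from the add-on laws** (`Cor55ShiftAction`). [cite: MochizukiAbsTopIII2015, Cor 5.5 (v) pp. 131–133] -/
theorem cor55ShiftAction_of_iotaOver_lamOverLink [Nonempty Vmod] (hsq : ∀ v, L.IotaSquaresCommute v)
    (hι : L.IotaOver) (hΛ : L.LamOverLink) : L.Cor55ShiftAction :=
  (L.realises_and_cor55ShiftAction_of_iotaOver_lamOverLink hsq hι hΛ).2

/-- **F-0156 from the add-on laws and total `□`-rigidity** (`Cor55Rigidity = Cor55CoreRigid ∧ Cor55ShiftAction`).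
[cite: MochizukiAbsTopIII2015, Cor 5.5 (v) pp. 131–133] -/
theorem cor55Rigidity_of_iotaOver_lamOverLink [Nonempty Vmod] (hsq : ∀ v, L.IotaSquaresCommute v)
    (hι : L.IotaOver) (hΛ : L.LamOverLink) (hrig : L.Cor55CoreRigid) : L.Cor55Rigidity :=
  ⟨hrig, L.cor55ShiftAction_of_iotaOver_lamOverLink hsq hι hΛ⟩

/-- Under the add-on laws F-0157 is EXACTLY "`V(F_mod) ≠ ∅`". [cite: MochizukiAbsTopIII2015, Cor 5.5 (v) pp. 131–133] -/
theorem cor55ShiftAction_iff_nonempty_of_iotaOver_lamOverLink (hsq : ∀ v, L.IotaSquaresCommute v) (hι : L.IotaOver)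
    (hΛ : L.LamOverLink) : L.Cor55ShiftAction ↔ Nonempty Vmod :=
  ⟨L.nonempty_of_cor55ShiftAction, fun h =>
    haveI := h
    L.cor55ShiftAction_of_iotaOver_lamOverLink hsq hι hΛ⟩

/-- Under the add-on laws F-0159 is EXACTLY "`V(F_mod) ≠ ∅`". [cite: MochizukiAbsTopIII2015, Cor 5.5 (iii) p. 131] -/
theorem exists_realisesCor55Families_iff_nonempty_of_iotaOver_lamOverLink (hsq : ∀ v, L.IotaSquaresCommute v)
    (hι : L.IotaOver) (hΛ : L.LamOverLink) :
    (∃ K : L.diagram.HomotopyFamily, L.RealisesCor55Families K) ↔ Nonempty Vmod :=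
  ⟨fun ⟨_, hK⟩ => L.nonempty_of_realisesCor55Families hK, fun h =>
    haveI := h
    L.exists_realisesCor55Families_of_iotaOver_lamOverLink hsq hι hΛ⟩

/-- Under the add-on laws F-0156 is EXACTLY "`𝒳` id-rigid and `V(F_mod) ≠ ∅`" (abc-iut-w5-d112's `cor55CoreRigid_iff`).
[cite: MochizukiAbsTopIII2015, Cor 5.5 (v) pp. 131–133] -/
theorem cor55Rigidity_iff_of_iotaOver_lamOverLink (hsq : ∀ v, L.IotaSquaresCommute v) (hι : L.IotaOver)
    (hΛ : L.LamOverLink) : L.Cor55Rigidity ↔ IsIdRigid L.X ∧ Nonempty Vmod :=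
  and_congr L.cor55CoreRigid_iff (L.cor55ShiftAction_iff_nonempty_of_iotaOver_lamOverLink hsq hι hΛ)

end Interface

/-! ## 2. The setting over a sub-model `ι : C ⥤ 𝒳` and the SLIM carrier (abc-iut-w4-d095) -/

section NonarchOver

open AbsTopIII

variable (p : ℕ) [Fact p.Prime] {C : Type 1} [Category.{1} C] (ι : C ⥤ TFModel p) (Vmod : Type 1)
  (isArc : Vmod → Bool)

/-- **F-0159 ∧ F-0157 HOLD over any sub-model `ι : C ⥤ 𝒳`** (for `V(F_mod) ≠ ∅`): all three THEOREM B inputs are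
theorems there. [cite: MochizukiAbsTopIII2015, Cor 5.5 (v) pp. 131–133] -/
theorem nonarchGenuineOver_realises_and_cor55ShiftAction [Nonempty Vmod] :
    (∃ K : (nonarchGenuineOver p ι Vmod isArc).diagram.HomotopyFamily,
        (nonarchGenuineOver p ι Vmod isArc).RealisesCor55Families K) ∧
      (nonarchGenuineOver p ι Vmod isArc).Cor55ShiftAction :=
  (nonarchGenuineOver p ι Vmod isArc).realises_and_cor55ShiftAction_of_iotaOver_lamOverLink
    (nonarchGenuineOver_iotaSquaresCommute p ι Vmod isArc) (nonarchGenuineOver_iotaOver p ι Vmod isArc)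
    (nonarchGenuineOver_lamOverLink p ι Vmod isArc)

/-- **F-0159 HOLDS over any sub-model.** [cite: MochizukiAbsTopIII2015, Cor 5.5 (iii) p. 131] -/
theorem nonarchGenuineOver_exists_realisesCor55Families [Nonempty Vmod] :
    ∃ K : (nonarchGenuineOver p ι Vmod isArc).diagram.HomotopyFamily,
      (nonarchGenuineOver p ι Vmod isArc).RealisesCor55Families K :=
  (nonarchGenuineOver_realises_and_cor55ShiftAction p ι Vmod isArc).1

/-- **F-0157 HOLDS over any sub-model.** [cite: MochizukiAbsTopIII2015, Cor 5.5 (v) pp. 131–133] -/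
theorem nonarchGenuineOver_cor55ShiftAction [Nonempty Vmod] : (nonarchGenuineOver p ι Vmod isArc).Cor55ShiftAction :=
  (nonarchGenuineOver_realises_and_cor55ShiftAction p ι Vmod isArc).2

/-- F-0157 over a sub-model is EXACTLY "`V(F_mod) ≠ ∅`". [cite: MochizukiAbsTopIII2015, Cor 5.5 (v) pp. 131–133] -/
theorem nonarchGenuineOver_cor55ShiftAction_iff :
    (nonarchGenuineOver p ι Vmod isArc).Cor55ShiftAction ↔ Nonempty Vmod :=
  (nonarchGenuineOver p ι Vmod isArc).cor55ShiftAction_iff_nonempty_of_iotaOver_lamOverLink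
    (nonarchGenuineOver_iotaSquaresCommute p ι Vmod isArc) (nonarchGenuineOver_iotaOver p ι Vmod isArc)
    (nonarchGenuineOver_lamOverLink p ι Vmod isArc)

/-- **F-0156 over a sub-model is EXACTLY "`C` id-rigid and `V(F_mod) ≠ ∅`"** (abc-iut-w4-d095's
`nonarchGenuineOver_cor55CoreRigid_iff`). [cite: MochizukiAbsTopIII2015, Cor 5.5 (v) pp. 131–133] -/
theorem nonarchGenuineOver_cor55Rigidity_iff_isIdRigid :
    (nonarchGenuineOver p ι Vmod isArc).Cor55Rigidity ↔ IsIdRigid C ∧ Nonempty Vmod :=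
  and_congr (nonarchGenuineOver_cor55CoreRigid_iff p ι Vmod isArc) (nonarchGenuineOver_cor55ShiftAction_iff p ι Vmod isArc)

/-- **F-0157 HOLDS at the SLIM genuine-nonarchimedean MLF carrier.** [cite: MochizukiAbsTopIII2015, Cor 5.5 (v) pp. 131–133] -/
theorem nonarchGenuineSlim_cor55ShiftAction [Nonempty Vmod] : (nonarchGenuineSlim p Vmod isArc).Cor55ShiftAction :=
  nonarchGenuineOver_cor55ShiftAction p _ Vmod isArc

/-- **F-0159 HOLDS at the slim carrier.** [cite: MochizukiAbsTopIII2015, Cor 5.5 (iii) p. 131] -/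
theorem nonarchGenuineSlim_exists_realisesCor55Families [Nonempty Vmod] :
    ∃ K : (nonarchGenuineSlim p Vmod isArc).diagram.HomotopyFamily,
      (nonarchGenuineSlim p Vmod isArc).RealisesCor55Families K :=
  nonarchGenuineOver_exists_realisesCor55Families p _ Vmod isArc

/-- **F-0156 HOLDS at the slim carrier**: Cor 5.5 (v) as one node — total `□`-rigidity (abc-iut-w4-d095's
`nonarchGenuineSlim_cor55CoreRigid`, Prop 3.2 (iv) at the model) AND the `ℤ`-action clause.
[cite: MochizukiAbsTopIII2015, Cor 5.5 (v) pp. 131–133] -/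
theorem nonarchGenuineSlim_cor55Rigidity [Nonempty Vmod] : (nonarchGenuineSlim p Vmod isArc).Cor55Rigidity :=
  ⟨nonarchGenuineSlim_cor55CoreRigid p Vmod isArc, nonarchGenuineSlim_cor55ShiftAction p Vmod isArc⟩

/-- F-0156 at the slim carrier is EXACTLY "`V(F_mod) ≠ ∅`". [cite: MochizukiAbsTopIII2015, Cor 5.5 (v) pp. 131–133] -/
theorem nonarchGenuineSlim_cor55Rigidity_iff_nonempty :
    (nonarchGenuineSlim p Vmod isArc).Cor55Rigidity ↔ Nonempty Vmod :=
  (nonarchGenuineSlim_cor55Rigidity_iff p Vmod isArc).trans (nonarchGenuineOver_cor55ShiftAction_iff p _ Vmod isArc)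

/-- **Every typed clause of Cor 5.5 (i)/(ii)/(iii)⊞/(v) and Cor 5.10 (iv)(a) HOLDS at the slim carrier** (for
`V(F_mod) ≠ ∅`): abc-iut-w4-d095's `nonarchGenuineSlim_cor55_cluster` completed by F-0157 / F-0156 / F-0159.
[cite: MochizukiAbsTopIII2015, Cor 5.5 p. 130] -/
theorem nonarchGenuineSlim_cor55_cluster' [Nonempty Vmod] :
    (nonarchGenuineSlim p Vmod isArc).Cor55Cores ∧ (nonarchGenuineSlim p Vmod isArc).Cor55Telecore ∧
      (nonarchGenuineSlim p Vmod isArc).Cor55Observables ∧ (nonarchGenuineSlim p Vmod isArc).Cor55CoreRigid ∧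
        (nonarchGenuineSlim p Vmod isArc).Cor510MonoCores ∧ (nonarchGenuineSlim p Vmod isArc).Cor55ShiftAction ∧
          (nonarchGenuineSlim p Vmod isArc).Cor55Rigidity ∧
            ∃ K : (nonarchGenuineSlim p Vmod isArc).diagram.HomotopyFamily,
              (nonarchGenuineSlim p Vmod isArc).RealisesCor55Families K :=
  let h := nonarchGenuineSlim_cor55_cluster p Vmod isArc
  ⟨h.1, h.2.1, h.2.2.1, h.2.2.2.1, h.2.2.2.2, nonarchGenuineSlim_cor55ShiftAction p Vmod isArc,
    nonarchGenuineSlim_cor55Rigidity p Vmod isArc, nonarchGenuineSlim_exists_realisesCor55Families p Vmod isArc⟩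

/-- The bare-model contrast for F-0156 in one line: over `ι = 𝟭` F-0157 holds but F-0156 FAILS (the base is not
id-rigid, abc-iut-w4-d020), over the slim inclusion both hold. [cite: MochizukiAbsTopIII2015, Cor 5.5 (v) pp. 131–133] -/
theorem cor55Rigidity_slim_not_bare [Nonempty Vmod] :
    (nonarchGenuineSlim p Vmod isArc).Cor55Rigidity ∧
      (nonarchGenuineOver p (𝟭 (TFModel p)) Vmod isArc).Cor55ShiftAction ∧
        ¬ (nonarchGenuineOver p (𝟭 (TFModel p)) Vmod isArc).Cor55Rigidity :=
  ⟨nonarchGenuineSlim_cor55Rigidity p Vmod isArc, nonarchGenuineOver_cor55ShiftAction p _ Vmod isArc,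
    fun h => (cor55CoreRigid_slim_not_bare p Vmod isArc).2 h.1⟩

end NonarchOver

/-! ## 3. The bare genuine-nonarchimedean settings `nonarchGenuine p`, `nonarchGenuineMono p` -/

section Nonarch

open AbsTopIII

variable (p : ℕ) [Fact p.Prime] (Vmod : Type 1) (isArc : Vmod → Bool)

/-- **F-0159 ∧ F-0157 HOLD at `nonarchGenuine p`** (for `V(F_mod) ≠ ∅`). [cite: MochizukiAbsTopIII2015, Cor 5.5 (v) pp. 131–133] -/
theorem nonarchGenuine_realises_and_cor55ShiftAction [Nonempty Vmod] :
    (∃ K : (nonarchGenuine p Vmod isArc).diagram.HomotopyFamily, (nonarchGenuine p Vmod isArc).RealisesCor55Families K) ∧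
      (nonarchGenuine p Vmod isArc).Cor55ShiftAction :=
  (nonarchGenuine p Vmod isArc).realises_and_cor55ShiftAction_of_iotaOver_lamOverLink
    (nonarchGenuine_iotaSquaresCommute p Vmod isArc) (nonarchGenuine_iotaOver p Vmod isArc)
    (nonarchGenuine_lamOverLink p Vmod isArc)

/-- **F-0157 HOLDS at `nonarchGenuine p`.** [cite: MochizukiAbsTopIII2015, Cor 5.5 (v) pp. 131–133] -/
theorem nonarchGenuine_cor55ShiftAction [Nonempty Vmod] : (nonarchGenuine p Vmod isArc).Cor55ShiftAction :=
  (nonarchGenuine_realises_and_cor55ShiftAction p Vmod isArc).2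

/-- F-0157 at `nonarchGenuine p` is EXACTLY "`V(F_mod) ≠ ∅`". [cite: MochizukiAbsTopIII2015, Cor 5.5 (v) pp. 131–133] -/
theorem nonarchGenuine_cor55ShiftAction_iff : (nonarchGenuine p Vmod isArc).Cor55ShiftAction ↔ Nonempty Vmod :=
  (nonarchGenuine p Vmod isArc).cor55ShiftAction_iff_nonempty_of_iotaOver_lamOverLink
    (nonarchGenuine_iotaSquaresCommute p Vmod isArc) (nonarchGenuine_iotaOver p Vmod isArc)
    (nonarchGenuine_lamOverLink p Vmod isArc)

/-- **At `nonarchGenuine p` F-0157 HOLDS while F-0156 FAILS** (abc-iut-w4-d020: the bare model base is not id-rigid) —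
so F-0156's failure there is entirely the total-`□`-rigidity conjunct F-0155. [cite: MochizukiAbsTopIII2015, Cor 5.5 (v) pp. 131–133] -/
theorem nonarchGenuine_cor55ShiftAction_not_cor55Rigidity [Nonempty Vmod] :
    (nonarchGenuine p Vmod isArc).Cor55ShiftAction ∧ ¬ (nonarchGenuine p Vmod isArc).Cor55Rigidity :=
  ⟨nonarchGenuine_cor55ShiftAction p Vmod isArc, nonarchGenuine_not_cor55Rigidity p Vmod isArc⟩

/-- **F-0159 ∧ F-0157 HOLD at `nonarchGenuineMono p`** (genuine mono-analytic rows; same holomorphic rows as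
`nonarchGenuine p`, so abc-iut-f-101's `IotaSquaresCommute` transfers verbatim). [cite: MochizukiAbsTopIII2015, Cor 5.5 (v) pp. 131–133] -/
theorem nonarchGenuineMono_realises_and_cor55ShiftAction [Nonempty Vmod] :
    (∃ K : (nonarchGenuineMono p Vmod isArc).diagram.HomotopyFamily,
        (nonarchGenuineMono p Vmod isArc).RealisesCor55Families K) ∧
      (nonarchGenuineMono p Vmod isArc).Cor55ShiftAction :=
  (nonarchGenuineMono p Vmod isArc).realises_and_cor55ShiftAction_of_iotaOver_lamOverLink
    (nonarchGenuine_iotaSquaresCommute p Vmod isArc) (nonarchGenuineMono_iotaOver p Vmod isArc)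
    (nonarchGenuineMono_lamOverLink p Vmod isArc)

/-- **F-0157 HOLDS at `nonarchGenuineMono p`** — and F-0156 FAILS there (abc-iut-w4-d020).
[cite: MochizukiAbsTopIII2015, Cor 5.5 (v) pp. 131–133] -/
theorem nonarchGenuineMono_cor55ShiftAction_not_cor55Rigidity [Nonempty Vmod] :
    (nonarchGenuineMono p Vmod isArc).Cor55ShiftAction ∧ ¬ (nonarchGenuineMono p Vmod isArc).Cor55Rigidity :=
  ⟨(nonarchGenuineMono_realises_and_cor55ShiftAction p Vmod isArc).2, nonarchGenuineMono_not_cor55Rigidity p Vmod isArc⟩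

end Nonarch

/-! ## 4. The genuine-archimedean setting `archGenuine 𝔄` (abc-iut-L4-t15 / w4-d020 lineages) -/

section Arch

variable (𝔄 : AutHolFieldFunctor.{u}) (Vmod : Type (u + 1)) (isArc : Vmod → Bool)

/-- **F-0159 ∧ F-0157 HOLD at `archGenuine 𝔄`** (for `V(F_mod) ≠ ∅`). [cite: MochizukiAbsTopIII2015, Cor 5.5 (v) pp. 131–133] -/
theorem archGenuine_realises_and_cor55ShiftAction [Nonempty Vmod] :
    (∃ K : (archGenuine 𝔄 Vmod isArc).diagram.HomotopyFamily, (archGenuine 𝔄 Vmod isArc).RealisesCor55Families K) ∧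
      (archGenuine 𝔄 Vmod isArc).Cor55ShiftAction :=
  (archGenuine 𝔄 Vmod isArc).realises_and_cor55ShiftAction_of_iotaOver_lamOverLink
    (archGenuine_iotaSquaresCommute 𝔄 Vmod isArc) (archGenuine_iotaOver 𝔄 Vmod isArc) (archGenuine_lamOverLink 𝔄 Vmod isArc)

/-- **F-0157 HOLDS at `archGenuine 𝔄`.** [cite: MochizukiAbsTopIII2015, Cor 5.5 (v) pp. 131–133] -/
theorem archGenuine_cor55ShiftAction [Nonempty Vmod] : (archGenuine 𝔄 Vmod isArc).Cor55ShiftAction :=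
  (archGenuine_realises_and_cor55ShiftAction 𝔄 Vmod isArc).2

/-- F-0157 at `archGenuine 𝔄` is EXACTLY "`V(F_mod) ≠ ∅`". [cite: MochizukiAbsTopIII2015, Cor 5.5 (v) pp. 131–133] -/
theorem archGenuine_cor55ShiftAction_iff : (archGenuine 𝔄 Vmod isArc).Cor55ShiftAction ↔ Nonempty Vmod :=
  (archGenuine 𝔄 Vmod isArc).cor55ShiftAction_iff_nonempty_of_iotaOver_lamOverLink
    (archGenuine_iotaSquaresCommute 𝔄 Vmod isArc) (archGenuine_iotaOver 𝔄 Vmod isArc) (archGenuine_lamOverLink 𝔄 Vmod isArc)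

/-- **F-0156 at `archGenuine 𝔄` is EXACTLY the id-rigidity of `EA`** (for `V(F_mod) ≠ ∅`; abc-iut-w4-d020's
`archGenuine_cor55Rigidity_iff` with its F-0157 conjunct now discharged). [cite: MochizukiAbsTopIII2015, Cor 5.5 (v) pp. 131–133] -/
theorem archGenuine_cor55Rigidity_iff_isIdRigid_EA [Nonempty Vmod] :
    (archGenuine 𝔄 Vmod isArc).Cor55Rigidity ↔ IsIdRigid 𝔄.EA :=
  (archGenuine_cor55Rigidity_iff 𝔄 Vmod isArc).trans
    ⟨fun h => h.1, fun h => ⟨h, archGenuine_cor55ShiftAction 𝔄 Vmod isArc⟩⟩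

end Arch

/-- **F-0156 HOLDS at the genuine geometric archimedean carrier `{ℂ, ℂˣ, 𝔻}`** (for `V(F_mod) ≠ ∅`): total
`□`-rigidity by abc-iut-L4-t12's `HolRS.isIdRigid_EA_carriers` (`archGenuine_carriers_cor55CoreRigid`) and the
`ℤ`-action clause by THEOREM B. [cite: MochizukiAbsTopIII2015, Cor 5.5 (v) pp. 131–133] -/
theorem archGenuine_carriers_cor55Rigidity (Vmod : Type 1) (isArc : Vmod → Bool) [Nonempty Vmod] :
    (archGenuine (HolRS.geometricAutHolFieldFunctor
        (fun X : HolRS => X = HolRS.complexPlane ∨ X = HolRS.puncturedPlane ∨ X = HolRS.disc)) Vmod isArc).Cor55Rigidity :=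
  ⟨archGenuine_carriers_cor55CoreRigid Vmod isArc, archGenuine_cor55ShiftAction _ Vmod isArc⟩

open Literature.AlgebraicGeometry.Frobenioids (IsSlimGroup) in
/-- **F-0156 HOLDS at the archimedean Galois-category carrier of a SLIM profinite group** (for `V(F_mod) ≠ ∅`):
Lemma 4.3 ⇒ Prop 4.2 (i) for the rigidity conjunct (`archGenuine_ofGaloisCategory_cor55CoreRigid_of_isSlimGroup`),
THEOREM B for the `ℤ`-action. [cite: MochizukiAbsTopIII2015, Cor 5.5 (v) pp. 131–133] -/
theorem archGenuine_ofGaloisCategory_cor55Rigidity_of_isSlimGroup (G : Type) [Group G] [TopologicalSpace G]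
    [IsTopologicalGroup G] [CompactSpace G] [T2Space G] [TotallyDisconnectedSpace G] (hG : IsSlimGroup G)
    (Vmod : Type 1) (isArc : Vmod → Bool) [Nonempty Vmod] :
    (archGenuine (AutHolFieldFunctor.ofGaloisCategory G) Vmod isArc).Cor55Rigidity :=
  ⟨archGenuine_ofGaloisCategory_cor55CoreRigid_of_isSlimGroup G hG Vmod isArc, archGenuine_cor55ShiftAction _ Vmod isArc⟩

/-- **F-0156 at the archimedean Galois-category carrier is EXACTLY "`Z(Π) = 1` and `V(F_mod) ≠ ∅`"** — so F-0156
genuinely depends on the carrier (REFUTED for any `Π` with non-trivial centre, abc-iut-w4-d020's v2).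
[cite: MochizukiAbsTopIII2015, Cor 5.5 (v) pp. 131–133] -/
theorem archGenuine_ofGaloisCategory_cor55Rigidity_iff (G : Type) [Group G] [TopologicalSpace G]
    [IsTopologicalGroup G] [CompactSpace G] [TotallyDisconnectedSpace G] (Vmod : Type 1) (isArc : Vmod → Bool) :
    (archGenuine (AutHolFieldFunctor.ofGaloisCategory G) Vmod isArc).Cor55Rigidity ↔
      Subgroup.center G = ⊥ ∧ Nonempty Vmod :=
  and_congr (archGenuine_ofGaloisCategory_cor55CoreRigid_iff G Vmod isArc) (archGenuine_cor55ShiftAction_iff _ Vmod isArc)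

end LogFrobeniusSetting

end Literature.AnabelianGeometry.AbsoluteAnabelian
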